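import Literature.Geometry.Kaehler.ComplexTorusEllipticProductAmpleClasses
import Literature.Geometry.Kaehler.ComplexTorusEllipticCurveIsogenies
import Literature.Geometry.Kaehler.ComplexTorusPontryaginProduct
import Literature.Geometry.Kaehler.ComplexTorusTranscendentalLatticeShiodaMitani
import HarnessLib

/-!
# `NS(E_τ × E_τ')` through the curves `h`, `v`, `Γ_α` IN PERIODS: `h = p₂^*E_τ'`, `v = p₁^*E_τ`,
# `X_α(x, y) = E_τ'(αy₁, x₂) - E_τ'(αx₁, y₂)`, `deg α = |α|² Im τ/Im τ'`, `d = ab - |α|² Im τ/Im τ'`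

Layer `Literature/Geometry/Kaehler`, namespace `Literature.Geometry.Kaehler.ComplexTorus`; lane `lit-hodgefound`, seat
p07 (generation 50), file 88 of the seat lineage: files 84–85 (`ComplexTorusEllipticProductNeronSeveriGraphs`,
`…AmpleClasses`: Rosen–Shnidman's Prop. 2.3, §3, §4 for a product `E × E'` of one-dimensional complex tori with abstract
period maps `Ψ₁, Ψ₂` and positively oriented lattice enumerations) SPECIALISED to the upper-half-plane curves
`E_τ = ℂ/(ℤτ + ℤ)`, `E_τ' = ℂ/(ℤτ' + ℤ)` (`ellipticPeriod`, `τ, τ' ∈ ℍ`), where everything becomes a formula in the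
principal polarisations `E_τ(v, w) = Im(v w̄)/Im τ` (`ellipticForm`), `α ∈ Hom(E_τ, E_τ') = {α : αΛ_τ ⊆ Λ_τ'}` and
`Im τ, Im τ'`.  Consumed BY NAME: `orientationSign_ellipticPeriod_refl` (`(τ, 1)` is negatively oriented),
`orientationSign_comp_perm`, `pair_eq_apply_latticeFrame_mul_re_volumeForm` (file 84), `ellipticForm_apply_period`,
`det_eq_normSq_mul_im_div` and `natCard_ker_mapMatrixHom` (`#ker ρ(A) = |det A| = |α|² Im τ/Im τ'`), and the file-84/85
theorems `apply_of_carrier_eq_setOf_{snd,fst}_eq_zero`, `graph_sub_sub_smul_apply`, `intersectionForm_self_rosenShnidman`,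
`isRiemannForm_rosenShnidman_iff`, `isNSForm_iff_exists_rosenShnidman`.  Theorems only (no definition, no named fact, no
instance, no notation; net Literature debt `0`).

THE SOURCE, VERBATIM (held `paper:arxiv-1402.2233`): Rosen–Shnidman Prop. 2.3 (p0006) "`ℤ ⊕ Hom(E, E') ⊕ ℤ → NS(A)`,
`(a, λ, b) ↦ (a − 1)h + Γ_λ + (b − deg(λ))v`, is an isomorphism of groups"; §4 (p0009) "`X_λ := [Γ_λ] − h − mv`",
"`d = ½(L.L) = ac − b²m`", Lemma 4.1 "`L` is ample if and only if `d > 0` and `a, c > 0`".  F. Diamond, J. Shurman,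
*A First Course in Modular Forms* (2005), §1.3 p. 28 (`Im(γ(τ)) = det γ · Im τ/|j(γ, τ)|²`, whence the degree
`|m|² Im τ/Im τ'` of `z ↦ mz : E_τ → E_τ'`, the tree's `det_eq_normSq_mul_im_div`).  H. Lange (2023), §2.1.1 Example
2.1.3 (the Riemann form `E = Im H`, `H(v, w) = v w̄/Im τ` of `E_τ`).

THE MODEL: `τ τ' : ℍ`, `E_τ × E_τ' = ComplexTorus (prodPeriodL2 (ellipticPeriod _) (ellipticPeriod _))` on `ℂ ⊞ ℂ =
WithLp 2 (ℂ × ℂ)`, `e : Fin 4 ≃ Fin 2 ⊕ Fin 2` positively oriented (hypothesis `he`); the factors carry the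
positively oriented enumeration `(λ₁, λ₀) = (1, τ)` = `Equiv.swap 0 1` (§1), for which `vol = −E_τ`; hypotheses
`Zh Zv ZΓ / hZh hZv hZΓ / ah av aΓ / θh θv θΓ / hθh hθv hθΓ` present the curves `h`, `v`, `Γ_α` and their Néron–Severi
classes exactly as in file 84; `α : E_τ → E_τ'` is given by `hA : ellipticPeriod τ' (A x) = α · ellipticPeriod τ x`.

* §1 `E_τ`: **`orientationSign_ellipticPeriod_swap`** (`(1, τ)` is positively oriented for `Im τ > 0`),
  **`ellipticForm_eq_neg_re_volumeForm_swap`** / `volumeForm_ellipticPeriod_swap` (`vol_{(1,τ)} = −E_τ`).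
* §2 `E_τ × E_τ'`: **`apply_axes_ellipticPeriod`** / `axes_eq_compContinuousLinearMap_ellipticForm` (`θ_h = p₂^*E_τ'`,
  `θ_v = p₁^*E_τ`), **`natCard_ker_eq_normSq_mul_im_div`** (`deg α = |α|² Im τ/Im τ'`),
  **`graph_sub_sub_smul_apply_ellipticPeriod`** (`X_α(x, y) = E_τ'(αy₁, x₂) − E_τ'(αx₁, y₂)`),
  `apply_graph_ellipticPeriod` (`θ_Γ = p₂^*E_τ' + (|α|² Im τ/Im τ') p₁^*E_τ + X_α` pointwise),
  **`intersectionForm_self_rosenShnidman_ellipticPeriod`** (`((a−1)h + Γ_α + (b − deg α)v)² = 2(ab − |α|² Im τ/Im τ')`),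
  **`isRiemannForm_rosenShnidman_ellipticPeriod_iff`** (Lemma 4.1: ample iff `ab > |α|² Im τ/Im τ'`, `a, b > 0`),
  **`isNSForm_ellipticPeriod_iff_exists_rosenShnidman`** (Prop. 2.3 with `Hom(E_τ, E_τ')` as the `α ∈ ℂ`, `αΛ_τ ⊆ Λ_τ'`).

## References

* [RosenShnidman2014NeronSeveriProductSurfaces] J. Rosen, A. Shnidman, *Néron–Severi groups of product abelian
  surfaces*, arXiv:1402.2233 (2014), §2 Prop. 2.3, §4 (`X_λ`, `d = ac − b²m`, Lemma 4.1).
* [DiamondShurman2005] F. Diamond, J. Shurman, *A First Course in Modular Forms*, Springer GTM 228 (2005), §1.3 p. 28.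
* [Lange2023AbelianVarietiesComplex] H. Lange, *Abelian Varieties over the Complex Numbers*, Springer (2023), §2.1.1
  Example 2.1.3, §1.7.2 Lemma 1.7.5, §6.2.4 (p. 310).
* [Milne1999LefschetzClasses] J. S. Milne, *Lefschetz classes on abelian varieties*, Duke Math. J. 96 (1999), §4
  Prop. 4.1 (proof).
-/

noncomputable section

set_option maxSynthPendingDepth 3

open scoped Manifold ComplexOrder NNReal InnerProductSpace UpperHalfPlane
open Complex Set Function Module WithLp

namespace Literature.Geometry.Kaehler

namespace ComplexTorus

/-! ## §1 The elliptic curve `E_τ = ℂ/(ℤτ + ℤ)`, `Im τ > 0`: `(1, τ)` is positively oriented and `vol = -E_τ` -/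

section Line

variable {τ : ℂ} (hτ : 0 < τ.im)

include hτ in
/-- **The enumeration `(λ₁, λ₀) = (1, τ)` of the lattice basis of `ℤτ + ℤ` is POSITIVELY oriented** for `Im τ > 0`
(the identity enumeration `(τ, 1)` has sign `-1`, `orientationSign_ellipticPeriod_refl`; a transposition flips the
sign). [cite: Lange2023AbelianVarietiesComplex, §2.1.1 Example 2.1.3 and §1.7.2 Lemma 1.7.5] -/
theorem orientationSign_ellipticPeriod_swap :
    orientationSign (ellipticPeriod hτ.ne') (Equiv.swap (0 : Fin (2 * 1)) 1) = 1 := by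
  have h := orientationSign_comp_perm (ellipticPeriod hτ.ne') (Equiv.refl (Fin 2)) (Equiv.swap (0 : Fin 2) 1)
  rw [Equiv.Perm.sign_swap (by decide), orientationSign_ellipticPeriod_refl hτ] at h
  have e : (⇑(Equiv.refl (Fin 2)) ∘ ⇑(Equiv.swap (0 : Fin 2) 1)) = ⇑(Equiv.swap (0 : Fin (2 * 1)) 1) := rfl
  rw [e] at h
  rw [h]
  simp

include hτ in
/-- **`E_τ = -Re vol` for the positively oriented enumeration `(1, τ)`**: `E_τ(x, y) = -Re vol_{(1,τ)}(x, y)`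
(`E_τ(1, τ) = -1`: on lattice coordinates `E = x₀y₁ - x₁y₀` for `x = x₀τ + x₁`).
[cite: Lange2023AbelianVarietiesComplex, §2.1.1 Example 2.1.3] -/
theorem ellipticForm_eq_neg_re_volumeForm_swap (x y : ℂ) :
    ellipticForm hτ.ne' ![x, y] = -(volumeForm (ellipticPeriod hτ.ne') (Equiv.swap (0 : Fin (2 * 1)) 1) ![x, y]).re := by
  rw [pair_eq_apply_latticeFrame_mul_re_volumeForm (ellipticPeriod hτ.ne') (Equiv.swap (0 : Fin (2 * 1)) 1)
    (orientationSign_ellipticPeriod_swap hτ) (ellipticForm hτ.ne') x y]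
  have h0 : latticeFrame (ellipticPeriod hτ.ne') (Equiv.swap (0 : Fin (2 * 1)) 1) 0 =
      ellipticPeriod hτ.ne' (Pi.single 1 1) := by rw [latticeFrame_apply]; rfl
  have h1 : latticeFrame (ellipticPeriod hτ.ne') (Equiv.swap (0 : Fin (2 * 1)) 1) 1 =
      ellipticPeriod hτ.ne' (Pi.single 0 1) := by rw [latticeFrame_apply]; rfl
  rw [h0, h1, ellipticForm_apply_period]
  simp

include hτ in
/-- **`vol_{(1,τ)} = -E_τ` as complex forms** (`vol` is real). [cite: Lange2023AbelianVarietiesComplex, §2.1.1 Example 2.1.3 and §6.2.4 p. 310] -/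
theorem volumeForm_ellipticPeriod_swap :
    volumeForm (ellipticPeriod hτ.ne') (Equiv.swap (0 : Fin (2 * 1)) 1) = -ofRealForm (ellipticForm hτ.ne') := by
  ext v
  have hv : volumeForm (ellipticPeriod hτ.ne') (Equiv.swap (0 : Fin (2 * 1)) 1) v =
      volumeForm (ellipticPeriod hτ.ne') (Equiv.swap (0 : Fin (2 * 1)) 1) ![v 0, v 1] := by
    congr 1; funext i; fin_cases i <;> rfl
  have hv' : ellipticForm hτ.ne' v = ellipticForm hτ.ne' ![v 0, v 1] := by
    congr 1; funext i; fin_cases i <;> rfl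
  rw [ContinuousAlternatingMap.neg_apply, ofRealForm_apply, hv, hv', ellipticForm_eq_neg_re_volumeForm_swap hτ (v 0) (v 1),
    volumeForm_apply, Complex.ofReal_re, Complex.ofReal_neg, neg_neg]

end Line

/-! ## §2 `E_τ × E_τ'`: the classes `h`, `v`, `X_α` and `deg α` in terms of `E_τ`, `E_τ'`, `α`, `Im τ`, `Im τ'` -/

section Product

variable (τ τ' : ℍ) (e : Fin (2 * 2) ≃ Fin 2 ⊕ Fin 2)
  (he : orientationSign (prodPeriodL2 (ellipticPeriod τ.coe_im_pos.ne') (ellipticPeriod τ'.coe_im_pos.ne')) e = 1)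
  (Zh Zv : SubtorusFrame (prodPeriodL2 (ellipticPeriod τ.coe_im_pos.ne') (ellipticPeriod τ'.coe_im_pos.ne')) (2 * 1))
  (hZh : Zh.carrier 0 = {t | (prodHomeomorphL2 (ellipticPeriod τ.coe_im_pos.ne') (ellipticPeriod τ'.coe_im_pos.ne') t).2 = 0})
  (hZv : Zv.carrier 0 = {t | (prodHomeomorphL2 (ellipticPeriod τ.coe_im_pos.ne') (ellipticPeriod τ'.coe_im_pos.ne') t).1 = 0})
  (ah av : WithLp 2 (ℂ × ℂ)) {θh θv : WithLp 2 (ℂ × ℂ) [⋀^Fin 2]→L[ℝ] ℝ}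
  (hθh : analyticCycleClass (prodPeriodL2 (ellipticPeriod τ.coe_im_pos.ne') (ellipticPeriod τ'.coe_im_pos.ne')) e
    (show 2 * 1 + 2 * 1 = 2 * 2 from rfl) (Zh.hasPureDim_carrier ah) = ofRealForm (-θh))
  (hθv : analyticCycleClass (prodPeriodL2 (ellipticPeriod τ.coe_im_pos.ne') (ellipticPeriod τ'.coe_im_pos.ne')) e
    (show 2 * 1 + 2 * 1 = 2 * 2 from rfl) (Zv.hasPureDim_carrier av) = ofRealForm (-θv))
  {α : ℂ} (A : Matrix (Fin 2) (Fin 2) ℤ)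
  (hA : ∀ x : Fin 2 → ℝ, ellipticPeriod τ'.coe_im_pos.ne' ((A.map (Int.cast : ℤ → ℝ)).mulVec x) =
    α * ellipticPeriod τ.coe_im_pos.ne' x)
  (ZΓ : SubtorusFrame (prodPeriodL2 (ellipticPeriod τ.coe_im_pos.ne') (ellipticPeriod τ'.coe_im_pos.ne')) (2 * 1))
  (hZΓ : ZΓ.carrier 0 = {t | (prodHomeomorphL2 (ellipticPeriod τ.coe_im_pos.ne') (ellipticPeriod τ'.coe_im_pos.ne') t).2 =
    mapMatrix (ellipticPeriod τ.coe_im_pos.ne') (ellipticPeriod τ'.coe_im_pos.ne') A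
      (prodHomeomorphL2 (ellipticPeriod τ.coe_im_pos.ne') (ellipticPeriod τ'.coe_im_pos.ne') t).1})
  (aΓ : WithLp 2 (ℂ × ℂ)) {θΓ : WithLp 2 (ℂ × ℂ) [⋀^Fin 2]→L[ℝ] ℝ}
  (hθΓ : analyticCycleClass (prodPeriodL2 (ellipticPeriod τ.coe_im_pos.ne') (ellipticPeriod τ'.coe_im_pos.ne')) e
    (show 2 * 1 + 2 * 1 = 2 * 2 from rfl) (ZΓ.hasPureDim_carrier aΓ) = ofRealForm (-θΓ))

include hA in
/-- The analytic representation of `α` as a `ℂ`-linear map. [cite: Lange2023AbelianVarietiesComplex, §1.1.2 Prop. 1.1.6] -/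
private theorem hA_mul₈₈ : ∀ x : Fin 2 → ℝ, ellipticPeriod τ'.coe_im_pos.ne' ((A.map (Int.cast : ℤ → ℝ)).mulVec x) =
    ContinuousLinearMap.mul ℂ ℂ α (ellipticPeriod τ.coe_im_pos.ne' x) := fun x ↦ by
  rw [hA, ContinuousLinearMap.mul_apply']

include he hZh hθh hZv hθv in
/-- **`h = p₂^*E_τ'`, `v = p₁^*E_τ`**: the Néron–Severi classes of the axes of `E_τ × E_τ'` are the pull-backs of the
principal polarisations of the factors: `θ_h(x, y) = E_τ'(x₂, y₂)`, `θ_v(x, y) = E_τ(x₁, y₁)`.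
[cite: RosenShnidman2014NeronSeveriProductSurfaces, §2 Prop. 2.3 (the axes `h`, `v`)] [cite: Lange2023AbelianVarietiesComplex, §2.1.1 Example 2.1.3] -/
theorem apply_axes_ellipticPeriod (x y : WithLp 2 (ℂ × ℂ)) :
    θh ![x, y] = ellipticForm τ'.coe_im_pos.ne' ![(ofLp x).2, (ofLp y).2] ∧
      θv ![x, y] = ellipticForm τ.coe_im_pos.ne' ![(ofLp x).1, (ofLp y).1] := by
  have hh := apply_of_carrier_eq_setOf_snd_eq_zero (ellipticPeriod τ.coe_im_pos.ne') (ellipticPeriod τ'.coe_im_pos.ne')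
    (Equiv.swap (0 : Fin (2 * 1)) 1) (orientationSign_ellipticPeriod_swap τ.coe_im_pos) (Equiv.swap (0 : Fin (2 * 1)) 1)
    (orientationSign_ellipticPeriod_swap τ'.coe_im_pos) e he Zh hZh ah hθh ![x, y]
  have hv := apply_of_carrier_eq_setOf_fst_eq_zero (ellipticPeriod τ.coe_im_pos.ne') (ellipticPeriod τ'.coe_im_pos.ne')
    (Equiv.swap (0 : Fin (2 * 1)) 1) (orientationSign_ellipticPeriod_swap τ.coe_im_pos) (Equiv.swap (0 : Fin (2 * 1)) 1)
    (orientationSign_ellipticPeriod_swap τ'.coe_im_pos) e he Zv hZv av hθv ![x, y]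
  have e2 : (fun i ↦ (ofLp (![x, y] i)).2) = ![(ofLp x).2, (ofLp y).2] := by funext i; fin_cases i <;> rfl
  have e1 : (fun i ↦ (ofLp (![x, y] i)).1) = ![(ofLp x).1, (ofLp y).1] := by funext i; fin_cases i <;> rfl
  rw [e2] at hh
  rw [e1] at hv
  rw [hh, hv, ellipticForm_eq_neg_re_volumeForm_swap τ.coe_im_pos, ellipticForm_eq_neg_re_volumeForm_swap τ'.coe_im_pos]
  exact ⟨rfl, rfl⟩

include he hZh hθh hZv hθv in
/-- **`θ_h = p₂^*E_τ'`, `θ_v = p₁^*E_τ` as forms** (`pᵢ` the projections of `ℂ ⊞ ℂ`).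
[cite: RosenShnidman2014NeronSeveriProductSurfaces, §2 Prop. 2.3] [cite: Milne1999LefschetzClasses, §4 Prop. 4.1 (proof)] -/
theorem axes_eq_compContinuousLinearMap_ellipticForm :
    θh = (ellipticForm τ'.coe_im_pos.ne').compContinuousLinearMap
        ((ContinuousLinearMap.snd ℝ ℂ ℂ).comp (WithLp.prodContinuousLinearEquiv 2 ℝ ℂ ℂ : WithLp 2 (ℂ × ℂ) →L[ℝ] ℂ × ℂ)) ∧
      θv = (ellipticForm τ.coe_im_pos.ne').compContinuousLinearMap
        ((ContinuousLinearMap.fst ℝ ℂ ℂ).comp (WithLp.prodContinuousLinearEquiv 2 ℝ ℂ ℂ : WithLp 2 (ℂ × ℂ) →L[ℝ] ℂ × ℂ)) := by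
  have h := apply_axes_ellipticPeriod τ τ' e he Zh Zv hZh hZv ah av hθh hθv
  constructor
  · ext v
    have hv : θh v = θh ![v 0, v 1] := by congr 1; funext i; fin_cases i <;> rfl
    rw [hv, (h (v 0) (v 1)).1, ContinuousAlternatingMap.compContinuousLinearMap_apply]
    congr 1; funext i; fin_cases i <;> rfl
  · ext v
    have hv : θv v = θv ![v 0, v 1] := by congr 1; funext i; fin_cases i <;> rfl
    rw [hv, (h (v 0) (v 1)).2, ContinuousAlternatingMap.compContinuousLinearMap_apply]
    congr 1; funext i; fin_cases i <;> rfl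

include hA in
/-- **`deg α = #ker α = |α|² · Im τ / Im τ'`** for the homomorphism `α : E_τ → E_τ'`, `z ↦ αz` (`αΛ_τ ⊆ Λ_τ'` with matrix
`A`; `#ker = |det A|`, `det A = |α|² Im τ/Im τ'`; for `α = 0` both sides vanish, the kernel being infinite).
[cite: DiamondShurman2005, §1.3 p. 28] [cite: RosenShnidman2014NeronSeveriProductSurfaces, §2 Prop. 2.3 (`deg λ`)] -/
theorem natCard_ker_eq_normSq_mul_im_div :
    (Nat.card (mapMatrixHom (ellipticPeriod τ.coe_im_pos.ne') (ellipticPeriod τ'.coe_im_pos.ne') A).ker : ℝ) =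
      Complex.normSq α * τ.im / τ'.im := by
  have hdet := det_eq_normSq_mul_im_div τ τ' hA
  have hnn : (0 : ℝ) ≤ A.det := by
    rw [hdet]
    exact div_nonneg (mul_nonneg (Complex.normSq_nonneg α) τ.coe_im_pos.le) τ'.coe_im_pos.le
  have hnn' : 0 ≤ A.det := by exact_mod_cast hnn
  rw [natCard_ker_mapMatrixHom, Nat.cast_natAbs, abs_of_nonneg hnn', hdet]

include he hZh hθh hZv hθv hA hZΓ hθΓ in
/-- **ROSEN–SHNIDMAN'S `X_α = [Γ_α] - h - deg(α) v` ON `E_τ × E_τ'`, POINTWISE**: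
`X_α(x, y) = E_τ'(α y₁, x₂) - E_τ'(α x₁, y₂)`, with `deg α = |α|² Im τ/Im τ'`.
[cite: RosenShnidman2014NeronSeveriProductSurfaces, §4 ("`X_λ := [Γ_λ] − h − mv`")] -/
theorem graph_sub_sub_smul_apply_ellipticPeriod (x y : WithLp 2 (ℂ × ℂ)) :
    (θΓ - θh - (Nat.card (mapMatrixHom (ellipticPeriod τ.coe_im_pos.ne') (ellipticPeriod τ'.coe_im_pos.ne') A).ker : ℝ) • θv)
        ![x, y] =
      ellipticForm τ'.coe_im_pos.ne' ![α * (ofLp y).1, (ofLp x).2] - ellipticForm τ'.coe_im_pos.ne' ![α * (ofLp x).1, (ofLp y).2] := by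
  rw [graph_sub_sub_smul_apply (ellipticPeriod τ.coe_im_pos.ne') (ellipticPeriod τ'.coe_im_pos.ne')
    (Equiv.swap (0 : Fin (2 * 1)) 1) (orientationSign_ellipticPeriod_swap τ.coe_im_pos) (Equiv.swap (0 : Fin (2 * 1)) 1)
    (orientationSign_ellipticPeriod_swap τ'.coe_im_pos) e he Zh Zv hZh hZv ah av hθh hθv (hA_mul₈₈ τ τ' A hA) ZΓ hZΓ aΓ hθΓ,
    ContinuousLinearMap.mul_apply', ContinuousLinearMap.mul_apply', ellipticForm_eq_neg_re_volumeForm_swap τ'.coe_im_pos,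
    ellipticForm_eq_neg_re_volumeForm_swap τ'.coe_im_pos]
  ring

include he hZh hθh hZv hθv hA hZΓ hθΓ in
/-- **`Γ_α = h + deg(α) v + X_α` on `E_τ × E_τ'`, pointwise in terms of `E_τ`, `E_τ'`:**
`θ_Γ(x, y) = E_τ'(x₂, y₂) + (|α|² Im τ/Im τ') E_τ(x₁, y₁) + E_τ'(α y₁, x₂) - E_τ'(α x₁, y₂)`.
[cite: RosenShnidman2014NeronSeveriProductSurfaces, §2 Prop. 2.3 and §4] -/
theorem apply_graph_ellipticPeriod (x y : WithLp 2 (ℂ × ℂ)) :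
    θΓ ![x, y] = ellipticForm τ'.coe_im_pos.ne' ![(ofLp x).2, (ofLp y).2] +
      Complex.normSq α * τ.im / τ'.im * ellipticForm τ.coe_im_pos.ne' ![(ofLp x).1, (ofLp y).1] +
        (ellipticForm τ'.coe_im_pos.ne' ![α * (ofLp y).1, (ofLp x).2] -
          ellipticForm τ'.coe_im_pos.ne' ![α * (ofLp x).1, (ofLp y).2]) := by
  have hX := graph_sub_sub_smul_apply_ellipticPeriod τ τ' e he Zh Zv hZh hZv ah av hθh hθv A hA ZΓ hZΓ aΓ hθΓ x y
  have hax := apply_axes_ellipticPeriod τ τ' e he Zh Zv hZh hZv ah av hθh hθv x y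
  rw [ContinuousAlternatingMap.sub_apply, ContinuousAlternatingMap.sub_apply, ContinuousAlternatingMap.smul_apply,
    natCard_ker_eq_normSq_mul_im_div τ τ' A hA, hax.1, hax.2, smul_eq_mul] at hX
  linarith

include he hZh hθh hZv hθv hA hZΓ hθΓ in
/-- **`d = ab - |α|² Im τ/Im τ'`**: the class `(a - 1)h + Γ_α + (b - deg α)v = ah + X_α + bv` has self-intersection
`2(ab - |α|² Im τ/Im τ')`. [cite: RosenShnidman2014NeronSeveriProductSurfaces, §4 ("`d = ½(L.L) = ac − b²m`")] -/
theorem intersectionForm_self_rosenShnidman_ellipticPeriod (a b : ℝ) :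
    intersectionForm (g := 2) (prodPeriodL2 (ellipticPeriod τ.coe_im_pos.ne') (ellipticPeriod τ'.coe_im_pos.ne')) e
        ((a - 1) • θh + θΓ +
          (b - (Nat.card (mapMatrixHom (ellipticPeriod τ.coe_im_pos.ne') (ellipticPeriod τ'.coe_im_pos.ne') A).ker : ℝ)) • θv)
        ((a - 1) • θh + θΓ +
          (b - (Nat.card (mapMatrixHom (ellipticPeriod τ.coe_im_pos.ne') (ellipticPeriod τ'.coe_im_pos.ne') A).ker : ℝ)) • θv) =
      2 * (a * b - Complex.normSq α * τ.im / τ'.im) := by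
  rw [intersectionForm_self_rosenShnidman (ellipticPeriod τ.coe_im_pos.ne') (ellipticPeriod τ'.coe_im_pos.ne') e he Zh Zv
    hZh hZv ah av hθh hθv A ZΓ hZΓ aΓ hθΓ a b, natCard_ker_eq_normSq_mul_im_div τ τ' A hA]

include he hZh hθh hZv hθv hA hZΓ hθΓ in
/-- **ROSEN–SHNIDMAN LEMMA 4.1 ON `E_τ × E_τ'`: `ah + X_α + bv` (`a, b ∈ ℤ`) is ample iff `ab > |α|² Im τ/Im τ'` and
`a, b > 0`.** [cite: RosenShnidman2014NeronSeveriProductSurfaces, §4 Lemma 4.1] -/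
theorem isRiemannForm_rosenShnidman_ellipticPeriod_iff (a b : ℤ) :
    IsRiemannForm (prodPeriodL2 (ellipticPeriod τ.coe_im_pos.ne') (ellipticPeriod τ'.coe_im_pos.ne'))
        (((a : ℝ) - 1) • θh + θΓ +
          ((b : ℝ) - (Nat.card (mapMatrixHom (ellipticPeriod τ.coe_im_pos.ne') (ellipticPeriod τ'.coe_im_pos.ne') A).ker : ℝ)) •
            θv) ↔
      Complex.normSq α * τ.im / τ'.im < (a : ℝ) * b ∧ 0 < a ∧ 0 < b := by
  rw [isRiemannForm_rosenShnidman_iff (ellipticPeriod τ.coe_im_pos.ne') (ellipticPeriod τ'.coe_im_pos.ne')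
    (Equiv.swap (0 : Fin (2 * 1)) 1) (Equiv.swap (0 : Fin (2 * 1)) 1) e he Zh Zv hZh hZv ah av hθh hθv A ZΓ hZΓ aΓ hθΓ a b,
    ← natCard_ker_eq_normSq_mul_im_div τ τ' A hA]
  set m : ℕ := Nat.card (mapMatrixHom (ellipticPeriod τ.coe_im_pos.ne') (ellipticPeriod τ'.coe_im_pos.ne') A).ker with hm
  have h : (0 : ℤ) < a * b - m ↔ (m : ℝ) < (a : ℝ) * b := by
    constructor
    · intro h
      have h1 : (m : ℤ) < a * b := by omega
      have h2 : ((m : ℤ) : ℝ) < ((a * b : ℤ) : ℝ) := Int.cast_lt.2 h1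
      push_cast at h2
      exact h2
    · intro h
      have h2 : ((m : ℤ) : ℝ) < ((a * b : ℤ) : ℝ) := by push_cast; exact h
      have h1 := Int.cast_lt.1 h2
      omega
  rw [h]

include he hZh hθh hZv hθv in
/-- **ROSEN–SHNIDMAN PROP. 2.3 FOR `E_τ × E_τ'`**: a real `2`-form `θ` on `ℂ ⊞ ℂ` is a Néron–Severi class of
`E_τ × E_τ'` iff `θ = (a - 1)h + Γ_α + (b - deg α)v` for integers `a, b` and an `α ∈ Hom(E_τ, E_τ') = {α : αΛ_τ ⊆ Λ_τ'}`
(integer matrix `A` with `α(x₀τ + x₁) = (Ax)₀τ' + (Ax)₁`), the class `θ_Γ` of the graph `Γ_α` taken with any presentation;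
`deg α = |α|² Im τ/Im τ'` (`natCard_ker_eq_normSq_mul_im_div`). [cite: RosenShnidman2014NeronSeveriProductSurfaces, §2 Prop. 2.3] -/
theorem isNSForm_ellipticPeriod_iff_exists_rosenShnidman {θ : WithLp 2 (ℂ × ℂ) [⋀^Fin 2]→L[ℝ] ℝ} :
    IsNSForm (prodPeriodL2 (ellipticPeriod τ.coe_im_pos.ne') (ellipticPeriod τ'.coe_im_pos.ne')) θ ↔
      ∃ (a b : ℤ) (α : ℂ) (A : Matrix (Fin 2) (Fin 2) ℤ),
        (∀ x : Fin 2 → ℝ, ellipticPeriod τ'.coe_im_pos.ne' ((A.map (Int.cast : ℤ → ℝ)).mulVec x) =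
          α * ellipticPeriod τ.coe_im_pos.ne' x) ∧
        ∀ (ZΓ : SubtorusFrame (prodPeriodL2 (ellipticPeriod τ.coe_im_pos.ne') (ellipticPeriod τ'.coe_im_pos.ne')) (2 * 1))
          (_ : ZΓ.carrier 0 = {t | (prodHomeomorphL2 (ellipticPeriod τ.coe_im_pos.ne') (ellipticPeriod τ'.coe_im_pos.ne') t).2 =
            mapMatrix (ellipticPeriod τ.coe_im_pos.ne') (ellipticPeriod τ'.coe_im_pos.ne') A
              (prodHomeomorphL2 (ellipticPeriod τ.coe_im_pos.ne') (ellipticPeriod τ'.coe_im_pos.ne') t).1})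
          (aΓ : WithLp 2 (ℂ × ℂ)) (θΓ : WithLp 2 (ℂ × ℂ) [⋀^Fin 2]→L[ℝ] ℝ)
          (_ : analyticCycleClass (prodPeriodL2 (ellipticPeriod τ.coe_im_pos.ne') (ellipticPeriod τ'.coe_im_pos.ne')) e
            (show 2 * 1 + 2 * 1 = 2 * 2 from rfl) (ZΓ.hasPureDim_carrier aΓ) = ofRealForm (-θΓ)),
          θ = ((a : ℝ) - 1) • θh + θΓ +
            ((b : ℝ) - (Nat.card (mapMatrixHom (ellipticPeriod τ.coe_im_pos.ne') (ellipticPeriod τ'.coe_im_pos.ne') A).ker : ℝ)) •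
              θv := by
  rw [isNSForm_iff_exists_rosenShnidman (ellipticPeriod τ.coe_im_pos.ne') (ellipticPeriod τ'.coe_im_pos.ne')
    (Equiv.swap (0 : Fin (2 * 1)) 1) (orientationSign_ellipticPeriod_swap τ.coe_im_pos) (Equiv.swap (0 : Fin (2 * 1)) 1)
    (orientationSign_ellipticPeriod_swap τ'.coe_im_pos) e he Zh Zv hZh hZv ah av hθh hθv]
  constructor
  · rintro ⟨a, b, A, L, hL, h⟩
    refine ⟨a, b, L 1, A, fun x ↦ ?_, h⟩
    rw [hL]
    have h1 : L (ellipticPeriod τ.coe_im_pos.ne' x) = L (ellipticPeriod τ.coe_im_pos.ne' x • 1) := by rw [smul_eq_mul, mul_one]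
    rw [h1, L.map_smul, smul_eq_mul, mul_comm]
  · rintro ⟨a, b, α, A, hA', h⟩
    exact ⟨a, b, A, ContinuousLinearMap.mul ℂ ℂ α, hA_mul₈₈ τ τ' A hA', h⟩

end Product

end ComplexTorus

end Literature.Geometry.Kaehler
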